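import Summits.QuantumFields.YangMills.Theorems.BalabanUVNodesN18CombStepC1SharpRecordLetters
import Summits.QuantumFields.YangMills.Theorems.BalabanUVNodesN18CombStepSharpLetters
import HarnessLib

/-!
# BalabanUVNodes ∕ node N18 = NE5 — closure-ledger item (iii), comb step M4c, file (6f):
# THE SHARP LETTERS `δ₁`, `a₁` AT THE TABLE WITH THE SHARP C¹ CANCELLED SUM `S₁♯` — no `1∕η_j`, no `2R∕ξ²`

(Track A, DAG node N18 = `T4OutputRate.NE5`; cluster K4 «SpineRates», key item K3⁸ `SpineGivenEndpointR13SepCoPHV` (stmt-QuantumFields-27366);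
seat pub-ymgap-dag-n18-w3 g5, INTENT-6 = design step M4c.)  Count-neutral helper (`--supports stmt-QuantumFields-27366 --as helper`); K3⁸∕K3⁷ NOT claimed,
NOT closed; YM mass gap (Clay) NOT proved by any of this; R4 closes the conditional finite-𝕋⁴ rung `BalabanLadder.UV` only.

WHAT.  (5b) `comb_letters_sharp_TΦOfRecord` verbatim with (4e) replaced by (6e) `comb_letters_C1sharp_TΦOfRecord`: the same `l`, (1) `tr l = 0`, (2) `‖l‖ ≤ ηℓα₁B`,
(3♯) `‖∇^ξ l‖ ≤ D₁`, (4) `‖Pot − i∇l‖ ≤ S₀`, (5♯♯) `‖∇^ξ(Pot − i∇l)‖ ≤ S₁♯`, (6♯) `‖∇^ξ Pot‖ ≤ S₁♯ + 2D₁∕ξ`, where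
`S₁♯ = ξ⁻¹·[(η∕ξ)L(69ℓtα₁B + L(ηα₁B + 2tα₁B)) + 2(η∕ξ)69ℓ²tα₁B + 4(17ℓt)(R∕ξ + (η∕ξ)3ℓ²tα₁B) + (η∕ξ)3ℓ²tα₁B + ξ⁻¹·800000ℓ²σ(η·L(ηα₁B + 2tα₁B) + 2t)]`
(EVERY side term `O(η_j)`; the `2R∕ξ²` floor is gone).  Extra displayed numerics w.r.t. (5b): `0 < t`, `384ℓσ ≤ 1`.
* `comb_letters_sharp2_TΦOfRecord`.

0 `def`, 0 `sorry`.  References: T. Bałaban, CMP **98** (1985) [Balaban1985Averaging] (Prop. 3 (122)–(126) p.36, (62)–(63) p.28); CMP **109** (1987) [Balaban1987RG1]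
((0.4) p.253, (0.24)–(0.25) p.257, (1.10)–(1.16) p.262, (2.17) p.269); C. King, CMP **102** (1986) [King1986] ((3.43)–(3.47) p.661).
-/

noncomputable section

open scoped BigOperators Matrix.Norms.L2Operator
open NormedSpace

namespace YMDAG.N18.TransportOfRecord

open Complex (I)
open Literature.MathematicalPhysics.QuantumFieldTheory.Balaban1983to89
open Literature.MathematicalPhysics.QuantumFieldTheory.Balaban1983to89.T4Continuum
open Literature.MathematicalPhysics.QuantumFieldTheory.Balaban1983to89.T4LevelShift
open Literature.MathematicalPhysics.QuantumFieldTheory.Balaban1983to89.BlockAveraging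
open Literature.MathematicalPhysics.QuantumFieldTheory.Balaban1983to89.BlockAveragingEMLLinearised (combMean)
open Literature.MathematicalPhysics.QuantumFieldTheory.Balaban1983to89.B12RegularSpaces111
open Literature.MathematicalPhysics.QuantumFieldTheory.Balaban1983to89.B12RegularSpaces111SpecialUnitary (suModel mem_suModel_G mem_suModel_gc suModel_norm_le)
open Literature.MathematicalPhysics.QuantumFieldTheory.Balaban1983to89.MatrixLog (mlog)
open Literature.MathematicalPhysics.QuantumFieldTheory.Balaban1983to89.B7Prop1Explicit (U1 mem_U1)
open Literature.MathematicalPhysics.QuantumFieldTheory.Balaban1983to89.B10Eq27TorusAxialLog (axialT)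
open Literature.MathematicalPhysics.QuantumFieldTheory.Balaban1983to89.T4TermwiseBCH (norm_units_conj_le)
open Literature.MathematicalPhysics.QuantumFieldTheory.Balaban1983to89.Node00 (MatA)
open Literature.MathematicalPhysics.QuantumFieldTheory.Balaban1983to89.Node00.Sect2 (regionOfSet domSys domSites frameI Residual)
open Literature.MathematicalPhysics.QuantumFieldTheory.Balaban1983to89.Node00.W1
open YMDAG.N18.AvgPotential (twoBlocks_subset_bonds_preimage)
open YMDAG.N18.TwoRunCubes (ladder domSites_pairOfRecord_eq_preimage)

section Record

variable {F : T4Family} {N : ℕ} [NeZero N] {M k : ℕ}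

/-- ★★★ **THE COMB GENERATOR OF RECORD WITH ALL LETTERS SHARP BUT `δ₀`'s and `s₀`'s natural forms.**  Per table point `(j, Y)` and run-B data `Factors ∕ CondI ∕ CondII`,
with `A′_X`, `U_A`, `R`, `S₀`, `S₁` as in (4e) and `D₁ := (η∕ξ)·(69ℓ²·t·α₁B + ℓ·L·(η·α₁B + 2t·α₁B))`: there is `l` (formula displayed) with (1) `tr l = 0`; (2) `‖l‖ ≤ ηℓα₁B`
on `domSites Y`; (3♯) `‖∇^ξ_{U_A,μ} l(x)‖ ≤ D₁` on `domSites Y`'s unit steps; (4) `‖Pot − i∇l‖ ≤ S₀` on the frame bonds; (5♯) `‖∇^ξ_{U_A,ν}(Pot − i∇l)(·,μ)(x)‖ ≤ S₁`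
and (6) `‖∇^ξ_{U_A,ν}Pot(·,μ)(x)‖ ≤ S₁ + 2D₁∕ξ` on the frame's direction pairs.  Displayed numerics: `ηα₁B ≤ 1∕4`, `((d+4)L∕2)α₀Bη² ≤ t`,
`0 < t`, `384ℓ((2ηα₁B + t + 2ηα₁B·t) + t) ≤ 1`; `S₁` = the sharp `S₁♯` of (6e). [cite: Balaban1985Averaging, Prop. 3 (122)-(126) p.36, (62)-(63) p.28; Balaban1987RG1, (0.4) p.253, (0.24)-(0.25) p.257, (1.10)-(1.16) p.262] -/
theorem comb_letters_sharp2_TΦOfRecord (Rz : Residual (F.P (k + 1)) (MatA N)) (j : ℕ) (Y : (domSys (F.P k) M j).Dom)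
    [DecidablePred (· ∈ (frameI Rz M (j + 1) (domSites (F.P (k + 1)) M (j + 1) (pairOfRecord F M k ⟨j, Y⟩).2)).X.bonds)] {cB : StepConsts} {α₀B α₁B : ℝ}
    {Φ : FieldPair (F.P (k + 1)) 0 (MatA N)ˣ (MatA N)} {U : PBond (F.P (k + 1)) 0 → (MatA N)ˣ} {A' : PBond (F.P (k + 1)) 0 → MatA N}
    (hcBξ : cB.ξ = (F.P (k + 1)).eta (j + 1))
    (hf : Factors cB Φ.U U A')
    (hI : CondI (suModel N) (frameI Rz M (j + 1) (domSites (F.P (k + 1)) M (j + 1) (pairOfRecord F M k ⟨j, Y⟩).2)) cB α₀B U)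
    (hII : CondII (suModel N) (frameI Rz M (j + 1) (domSites (F.P (k + 1)) M (j + 1) (pairOfRecord F M k ⟨j, Y⟩).2)).X cB α₁B U A')
    (hα0 : 0 ≤ α₀B) (hα1 : 0 ≤ α₁B) (hξ₁ : (F.P (k + 1)).eta (j + 1) * α₁B ≤ 1 / 4) {t : ℝ}
    (hRt : (((((F.P (k + 1)).d + 4) * (F.P (k + 1)).L : ℕ) : ℝ) / 2) * (α₀B * (F.P (k + 1)).eta (j + 1) ^ 2) ≤ t)
    (ht : 0 < t) (hℓ : 384 * (((((F.P (k + 1)).d + 2) * (F.P (k + 1)).L : ℕ) : ℝ)) *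
      ((2 * ((F.P (k + 1)).eta (j + 1) * α₁B) + t + 2 * ((F.P (k + 1)).eta (j + 1) * α₁B) * t) + t) ≤ 1)
    (hUA1 : ∀ b ∈ (frameI (Residual.unit (F.P k) (MatA N)) M j (domSites (F.P k) M j Y)).X.bonds,
      fieldShift (ladder F k) (avgUnits U) b ∈ U1 (MatA N)) :
    let X := (frameI Rz M (j + 1) (domSites (F.P (k + 1)) M (j + 1) (pairOfRecord F M k ⟨j, Y⟩).2)).X
    let AX : PBond (F.P (k + 1)) 0 → MatA N := fun b => if b ∈ X.bonds then A' b else 0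
    let UA : PBond (F.P k) 0 → (MatA N)ˣ := fieldShift (ladder F k) (avgUnits U)
    let R : ℝ := (4 * (34 * (((((F.P (k + 1)).d + 2) * (F.P (k + 1)).L : ℕ) : ℝ)) * ((2 * ((F.P (k + 1)).eta (j + 1) * α₁B) + t + 2 * ((F.P (k + 1)).eta (j + 1) * α₁B) * t) + t)) ^ 2 +
        578 * (((((F.P (k + 1)).d + 2) * (F.P (k + 1)).L : ℕ) : ℝ)) ^ 2 * ((2 * ((F.P (k + 1)).eta (j + 1) * α₁B) + t + 2 * ((F.P (k + 1)).eta (j + 1) * α₁B) * t) + t) * t +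
        660 * (((((F.P (k + 1)).d + 2) * (F.P (k + 1)).L : ℕ) : ℝ)) ^ 2 * ((2 * ((F.P (k + 1)).eta (j + 1) * α₁B) + t + 2 * ((F.P (k + 1)).eta (j + 1) * α₁B) * t) ^ 2 + t ^ 2) +
        3 * (((((F.P (k + 1)).d + 2) * (F.P (k + 1)).L : ℕ) : ℝ)) * (2 * ((F.P (k + 1)).eta (j + 1) * α₁B) * t) +
        3 * (((((F.P (k + 1)).d + 2) * (F.P (k + 1)).L : ℕ) : ℝ)) * ((F.P (k + 1)).eta (j + 1) * α₁B) ^ 2)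
    let S₀ : ℝ := (F.P (k + 1)).eta (j + 1) / (F.P k).eta j * (((F.P (k + 1)).L : ℝ) * α₁B) + R / (F.P k).eta j +
      (F.P (k + 1)).eta (j + 1) / (F.P k).eta j * (69 * (((((F.P (k + 1)).d + 2) * (F.P (k + 1)).L : ℕ) : ℝ)) ^ 2 * t * α₁B)
    let S₁ : ℝ := ((F.P k).eta j)⁻¹ * ((F.P (k + 1)).eta (j + 1) / (F.P k).eta j * ((F.P (k + 1)).L : ℝ) * (69 * (((((F.P (k + 1)).d + 2) * (F.P (k + 1)).L : ℕ) : ℝ)) * t * α₁B + ((F.P (k + 1)).L : ℝ) * ((F.P (k + 1)).eta (j + 1) * α₁B + 2 * t * α₁B)) +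
      2 * ((F.P (k + 1)).eta (j + 1) / (F.P k).eta j * (69 * (((((F.P (k + 1)).d + 2) * (F.P (k + 1)).L : ℕ) : ℝ)) ^ 2 * t * α₁B)) +
      (4 * (17 * (((((F.P (k + 1)).d + 2) * (F.P (k + 1)).L : ℕ) : ℝ)) * t) * (R / (F.P k).eta j + (F.P (k + 1)).eta (j + 1) / (F.P k).eta j * (3 * (((((F.P (k + 1)).d + 2) * (F.P (k + 1)).L : ℕ) : ℝ)) ^ 2 * t * α₁B)) +
        (F.P (k + 1)).eta (j + 1) / (F.P k).eta j * (3 * (((((F.P (k + 1)).d + 2) * (F.P (k + 1)).L : ℕ) : ℝ)) ^ 2 * t * α₁B) +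
        ((F.P k).eta j)⁻¹ * (800000 * (((((F.P (k + 1)).d + 2) * (F.P (k + 1)).L : ℕ) : ℝ)) ^ 2 * ((2 * ((F.P (k + 1)).eta (j + 1) * α₁B) + t + 2 * ((F.P (k + 1)).eta (j + 1) * α₁B) * t) + t) * ((F.P (k + 1)).eta (j + 1) * (((F.P (k + 1)).L : ℝ) * ((F.P (k + 1)).eta (j + 1) * α₁B + 2 * t * α₁B)) + 2 * t))))
    let D₁ : ℝ := (F.P (k + 1)).eta (j + 1) / (F.P k).eta j *
      (69 * (((((F.P (k + 1)).d + 2) * (F.P (k + 1)).L : ℕ) : ℝ)) ^ 2 * t * α₁B +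
        (((((F.P (k + 1)).d + 2) * (F.P (k + 1)).L : ℕ) : ℝ)) * (((F.P (k + 1)).L : ℝ) * ((F.P (k + 1)).eta (j + 1) * α₁B + 2 * t * α₁B)))
    ∃ l : Site (F.P k) 0 → MatA N,
    (∀ x, l x = (I * ((F.P (k + 1)).eta (j + 1) : ℂ)) • combMean (adJ (axialT U (emb (siteShift (ladder F k) x))) AX) (siteShift (ladder F k) x)) ∧
    (∀ x, Matrix.trace (l x) = 0) ∧
    (∀ x ∈ domSites (F.P k) M j Y, ‖l x‖ ≤ (F.P (k + 1)).eta (j + 1) * ((((((F.P (k + 1)).d + 2) * (F.P (k + 1)).L : ℕ) : ℝ)) * α₁B)) ∧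
    (∀ (x : Site (F.P k) 0) (μ : Fin (F.P k).d), x ∈ domSites (F.P k) M j Y → x.shift μ ∈ domSites (F.P k) M j Y → ‖nabla ((F.P k).eta j) UA μ l x‖ ≤ D₁) ∧
    (∀ b ∈ (frameI (Residual.unit (F.P k) (MatA N)) M j (domSites (F.P k) M j Y)).X.bonds,
      ‖(I * ((F.P k).eta j : ℂ))⁻¹ • mlog ((((TΦOfRecord F N k Φ).U b : (MatA N)ˣ) : MatA N) * (((UA b)⁻¹ : (MatA N)ˣ) : MatA N)) -
        I • nabla ((F.P k).eta j) UA b.dir l b.src‖ ≤ S₀) ∧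
    (∀ q ∈ (frameI (Residual.unit (F.P k) (MatA N)) M j (domSites (F.P k) M j Y)).X.dpairs,
      ‖nabla ((F.P k).eta j) UA q.2.1
          (fun y => (I * ((F.P k).eta j : ℂ))⁻¹ • mlog ((((TΦOfRecord F N k Φ).U ⟨y, q.2.2⟩ : (MatA N)ˣ) : MatA N) * (((UA ⟨y, q.2.2⟩)⁻¹ : (MatA N)ˣ) : MatA N)) -
            I • nabla ((F.P k).eta j) UA q.2.2 l y) q.1‖ ≤ S₁) ∧
    (∀ q ∈ (frameI (Residual.unit (F.P k) (MatA N)) M j (domSites (F.P k) M j Y)).X.dpairs,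
      ‖nabla ((F.P k).eta j) UA q.2.1
          (fun y => (I * ((F.P k).eta j : ℂ))⁻¹ • mlog ((((TΦOfRecord F N k Φ).U ⟨y, q.2.2⟩ : (MatA N)ˣ) : MatA N) * (((UA ⟨y, q.2.2⟩)⁻¹ : (MatA N)ˣ) : MatA N))) q.1‖ ≤
        S₁ + 2 * D₁ / (F.P k).eta j) := by
  intro X AX UA R S₀ S₁ D₁
  set η : ℝ := (F.P (k + 1)).eta (j + 1) with hηdef
  set ξ : ℝ := (F.P k).eta j with hξdef
  set ℓ : ℝ := (((((F.P (k + 1)).d + 2) * (F.P (k + 1)).L : ℕ) : ℝ)) with hℓdef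
  have hη : 0 < η := pow_pos (inv_pos.mpr (Nat.cast_pos.mpr (F.P (k + 1)).L_pos)) _
  have hξ : 0 < ξ := pow_pos (inv_pos.mpr (Nat.cast_pos.mpr (F.P k).L_pos)) _
  have hℓ0 : 0 ≤ ℓ := Nat.cast_nonneg _
  have hj1 : 0 + 1 ≤ (F.P (k + 1)).m + (F.P (k + 1)).K := by simp only [T4Family.P_m, T4Family.P_K]; omega
  have hj2 : 0 + 2 ≤ (F.P (k + 1)).m + (F.P (k + 1)).K := by simp only [T4Family.P_m, T4Family.P_K]; have := F.hm; omega
  have hRt2 : (((((F.P (k + 1)).d + 2) * (F.P (k + 1)).L : ℕ) : ℝ) / 2) * (α₀B * η ^ 2) ≤ t := by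
    refine le_trans (mul_le_mul_of_nonneg_right ?_ (by positivity)) hRt
    gcongr; omega
  have ht0 : 0 ≤ t := le_trans (by positivity) hRt
  have hℓt : 136 * ℓ * t ≤ 1 := by
    nlinarith only [hℓ, hℓ0, ht0, mul_nonneg hη.le hα1, mul_nonneg (mul_nonneg hℓ0 (mul_nonneg hη.le hα1)) ht0]
  -- (6e)
  obtain ⟨l, hl, hltr, hl0, -, hS0, hS1⟩ := comb_letters_C1sharp_TΦOfRecord (M := M) (k := k) Rz j Y (Φ := Φ) hcBξ hf hI hII hα0 hα1 hξ₁ hRt ht hℓ hUA1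
  -- the region dictionary
  have hX : X = regionOfSet (F.P (k + 1)) ((fun x => (siteShift (ladder F k)).symm (blockOf x)) ⁻¹' domSites (F.P k) M j Y) := by
    show regionOfSet (F.P (k + 1)) (domSites (F.P (k + 1)) M (j + 1) (pairOfRecord F M k ⟨j, Y⟩).2) = _
    rw [domSites_pairOfRecord_eq_preimage]
  have hAXle : ∀ b, ‖AX b‖ ≤ α₁B := fun b => by
    by_cases hb : b ∈ X.bonds
    · simp only [AX, if_pos hb]; exact (hII.norm_lt b hb).le
    · simp only [AX, if_neg hb, norm_zero]; exact hα1
  have hAXeq : ∀ b ∈ X.bonds, AX b = A' b := fun b hb => by simp only [AX, if_pos hb]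
  -- (3♯): the sharp gradient of the comb generator at a unit step `⟨x, μ⟩` of `domSites Y`
  have h3 : ∀ (x : Site (F.P k) 0) (μ : Fin (F.P k).d), x ∈ domSites (F.P k) M j Y → x.shift μ ∈ domSites (F.P k) M j Y →
      ‖nabla ξ UA μ l x‖ ≤ D₁ := fun x μ hx hxμ => by
    have hb : (⟨x, μ⟩ : PBond (F.P k) 0) ∈ (regionOfSet (F.P k) (domSites (F.P k) M j Y)).bonds := ⟨hx, hxμ⟩
    set c : PBond (F.P (k + 1)) 1 := bondShift (ladder F k) ⟨x, μ⟩ with hc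
    have htwo : ∀ b' : PBond (F.P (k + 1)) 0, (blockOf b'.src = c.src ∨ blockOf b'.src = c.tgt) → (blockOf b'.tgt = c.src ∨ blockOf b'.tgt = c.tgt) →
        b' ∈ X.bonds := fun b' h1 h2 => by rw [hX]; exact twoBlocks_subset_bonds_preimage F k _ hb b' h1 h2
    have hsite : ∀ z : Site (F.P (k + 1)) 0, (blockOf z = c.src ∨ blockOf z = c.tgt) →
        (siteShift (ladder F k)).symm (blockOf z) ∈ domSites (F.P k) M j Y := fun z hz => by
      rcases hz with h | h
      · rw [h]; show (siteShift (ladder F k)).symm (siteShift (ladder F k) x) ∈ _; rw [Equiv.symm_apply_apply]; exact hx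
      · rw [h, bondShift_tgt, Equiv.symm_apply_apply]; exact hxμ
    have htwop : ∀ p : Plaq (F.P (k + 1)) 0, (blockOf p.src = c.src ∨ blockOf p.src = c.tgt) →
        (blockOf (p.src.shift p.μ) = c.src ∨ blockOf (p.src.shift p.μ) = c.tgt) → (blockOf (p.src.shift p.ν) = c.src ∨ blockOf (p.src.shift p.ν) = c.tgt) →
        (blockOf ((p.src.shift p.μ).shift p.ν) = c.src ∨ blockOf ((p.src.shift p.μ).shift p.ν) = c.tgt) → p ∈ X.plaqs := fun p h1 h2 h3 h4 => by
      rw [hX]; exact ⟨hsite _ h1, hsite _ h2, hsite _ h3, hsite _ h4⟩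
    have h5a := norm_transport_comb_sub_comb_le hj1 hj2 c.src c.dir (U := U) (A := AX) (η := η) (a := α₁B) (a₁ := α₁B) (α := α₀B * η ^ 2) (t := t)
      hη hα1 hα1 (by positivity) (fun b' h1 h2 => hAXle b') 
      (fun b' h1 h2 => by
        have hG := hI.gValued b' (htwo b' h1 h2)
        exact mem_U1.mpr ⟨suModel_norm_le _ hG, suModel_norm_le _ ((suModel N).G.inv_mem hG)⟩)
      (fun p h1 h2 h3 h4 => by rw [← hcBξ]; exact (hI.plaq_lt p (htwop p h1 h2 h3 h4)).le)
      (fun z κ hz hzμ hzκ hzμκ => by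
        have hq' : (z, c.dir, κ) ∈ X.dpairs := by rw [hX]; exact ⟨hsite _ hz, hsite _ hzμ, hsite _ hzκ, hsite _ hzμκ⟩
        have hb1 : (⟨z, κ⟩ : PBond (F.P (k + 1)) 0) ∈ X.bonds := by rw [hX]; exact ⟨hsite _ hz, hsite _ hzκ⟩
        have hb2 : (⟨z.shift c.dir, κ⟩ : PBond (F.P (k + 1)) 0) ∈ X.bonds := by rw [hX]; exact ⟨hsite _ hzμ, hsite _ hzμκ⟩
        rw [nabla_congr (U := U) (V := U) (F := fun w => AX ⟨w, κ⟩) (G := fun w => A' ⟨w, κ⟩) rfl (hAXeq _ hb1) (hAXeq _ hb2), ← hcBξ]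
        exact (hII.nabla_lt _ hq').le)
      hRt2 hℓt
    -- `∇^ξ_{U_A,μ} l(x) = (iη∕ξ)·(Ū m₊ Ū⁻¹ − m₋)`
    have hUAb : UA ⟨x, μ⟩ = avgUnits U c := rfl
    have hval : nabla ξ UA μ l x = ((ξ : ℂ)⁻¹ * (I * (η : ℂ))) •
        (((avgUnits U c : (MatA N)ˣ) : MatA N) * combMean (adJ (axialT U (emb (c.src.shift c.dir))) AX) (c.src.shift c.dir) *
          (((avgUnits U c)⁻¹ : (MatA N)ˣ) : MatA N) - combMean (adJ (axialT U (emb c.src)) AX) c.src) := by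
      unfold nabla
      rw [hl (x.shift μ), hl x, hUAb, siteShift_shift, mul_smul_comm, smul_mul_assoc, ← smul_sub, smul_smul]
      rfl
    rw [hval, norm_smul, norm_mul, norm_inv, Complex.norm_real, Real.norm_of_nonneg hξ.le, norm_mul, Complex.norm_I, one_mul, Complex.norm_real,
      Real.norm_of_nonneg hη.le]
    have h5a' := mul_le_mul_of_nonneg_left h5a (mul_nonneg (inv_nonneg.mpr hξ.le) hη.le)
    refine h5a'.trans (le_of_eq ?_)
    show _ = η / ξ * _
    rw [div_eq_mul_inv]; ring
  refine ⟨l, hl, hltr, hl0, h3, hS0, hS1, fun q hq => ?_⟩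
  -- (6): `Pot = (Pot − i∇l) + i∇l`, `∇` additive, (5♯) + the crude quotient of (3♯)
  obtain ⟨h0, hν, hμ, hνμ⟩ := hq
  have hUq : UA ⟨q.1, q.2.1⟩ ∈ U1 (MatA N) := hUA1 ⟨q.1, q.2.1⟩ ⟨h0, hν⟩
  have hsplit : (fun y => (I * (ξ : ℂ))⁻¹ • mlog ((((TΦOfRecord F N k Φ).U ⟨y, q.2.2⟩ : (MatA N)ˣ) : MatA N) * (((UA ⟨y, q.2.2⟩)⁻¹ : (MatA N)ˣ) : MatA N))) =
      fun y => ((I * (ξ : ℂ))⁻¹ • mlog ((((TΦOfRecord F N k Φ).U ⟨y, q.2.2⟩ : (MatA N)ˣ) : MatA N) * (((UA ⟨y, q.2.2⟩)⁻¹ : (MatA N)ˣ) : MatA N)) -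
        I • nabla ξ UA q.2.2 l y) + I • nabla ξ UA q.2.2 l y := by
    funext y; rw [sub_add_cancel]
  rw [hsplit, nabla_add_fun]
  refine (norm_add_le _ _).trans (add_le_add (hS1 q ⟨h0, hν, hμ, hνμ⟩) ?_)
  -- the crude quotient of `i∇_μ l` along `ν`
  refine (norm_nabla_le_add_div hξ _ q.1 q.2.1 hUq).trans ?_
  have ha := h3 q.1 q.2.2 h0 hμ
  have hb := h3 (q.1.shift q.2.1) q.2.2 hν hνμ
  rw [norm_smul, norm_smul, Complex.norm_I, one_mul, one_mul]
  rw [div_le_div_iff_of_pos_right hξ]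
  linarith

end Record

end YMDAG.N18.TransportOfRecord

end
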